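import Summits.Ventures.PercRepro.S1CoreCapSixTwoFour

/-!
# PercRepro — TOWARDS `Q*(6) = 16`: TWO SIMPLE 4-POINT LINES, THE SIMPLE CASE (p1, gen 25)

The second half of the case of two simple 4-point lines `L₁, L₂` (`S1CoreCapSixTwoFour`): no other line carries a
fat point. The other lines `T` are simple 3-point lines with at most two free lines over `P₀ = L₂ ∪ L₁` in any
order (`free_le_two`). The NON-CHORDS (`≥ 2` points off `P₀`, hence `≤ 1` on `P₀`) number `≤ 3` by the counting
lemma at budget `2`. For the CHORDS: two chords with distinct hubs `n ≠ m` cover every other line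
(`subset_of_free_le_two`), so every further line has its new points among `n, m` — at most one non-chord and
`≤ |L₁ ∖ L₂|` chords per hub; if all chords share a hub there are `≤ |L₁ ∖ L₂|` of them. Hence `#T ≤ 7` when
`L₁ ∩ L₂ ≠ ∅`. When `L₁ ∩ L₂ = ∅` any two lines of `T` placed before `L₁, L₂` spend the budget (`1 + 1 + 2 + 2`),
so every third line is covered by them (`subset_of_disjoint`) and two chords with a common hub force every line
through that hub: `≤ 1` chord per hub, `#T ≤ 3`. In all cases `#T ≤ 8` and the cap sum is `≤ 16`
(`sum_cap_le_of_simple`, `sum_cap_le_sixteen_of_two_four`). `proofs/P1-S4-CAPBRIDGE.md` §17. Axioms: standard.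
-/

namespace PercRepro

namespace S1

namespace FourCap

variable {β : Type} [DecidableEq β]

section TwoFourSimple

variable {w : β → ℕ} {ls : Finset (Finset β)}
  (h1 : ∀ L ∈ ls, ∀ v ∈ L, w v = 1 ∨ w v = 2)
  (h2 : ∀ L ∈ ls, 3 ≤ L.card ∧ wsum w L ≤ 5)
  (h3 : ∀ L ∈ ls, ∀ L' ∈ ls, L ≠ L' → (L ∩ L').card ≤ 1)
  (h4 : ∀ l : List (Finset β), l.Nodup → (∀ L ∈ l, L ∈ ls) → wsum w (unionL l) ≤ 6 + lineRank l)
  {L₁ L₂ : Finset β} (hL₁ : L₁ ∈ ls) (hL₂ : L₂ ∈ ls) (h12 : L₂ ≠ L₁)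
  (c1 : L₁.card = 4) (c2 : L₂.card = 4) (f1 : fat w L₁ = 0) (f2 : fat w L₂ = 0)
  (hrest : ∀ L ∈ ls, L ≠ L₁ → L ≠ L₂ → L.card = 3)

include h1 h2 h3 h4 hL₁ hL₂ h12 c1 c2 f1 f2 hrest in
/-- **Budget `2` without the fat points**: every list of other lines has at most two free lines over `P₀`. -/
theorem free_le_two (l : List (Finset β)) (hnd : l.Nodup) (hl : ∀ L ∈ l, L ∈ ls ∧ L ≠ L₁ ∧ L ≠ L₂) :
    freeCountR (L₂ ∪ L₁) l ≤ 2 := by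
  have := budget_two h1 h2 h3 h4 hL₁ hL₂ h12 c1 c2 f1 f2 hrest l hnd hl
  omega

include h1 h2 h3 h4 hL₁ hL₂ h12 c1 c2 f1 f2 hrest in
/-- **Two simple lines placed before disjoint `L₁, L₂` spend the budget** (`1 + 1 + 2 + 2`): every third line is
covered by them and `P₀`. -/
theorem subset_of_disjoint (hdisj : (L₂ ∩ L₁).card = 0) {X Y Z : Finset β}
    (hX : X ∈ ls) (hX1 : X ≠ L₁) (hX2 : X ≠ L₂) (hY : Y ∈ ls) (hY1 : Y ≠ L₁) (hY2 : Y ≠ L₂)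
    (hZ : Z ∈ ls) (hZ1 : Z ≠ L₁) (hZ2 : Z ≠ L₂) (hYX : Y ≠ X) (hZX : Z ≠ X) (hZY : Z ≠ Y)
    (fX : fat w X = 0) (fY : fat w Y = 0) : Z ⊆ L₂ ∪ (L₁ ∪ (Y ∪ X)) := by
  have hc := costSum_le h1 (two_le_card_of_spec' h2) h4 [Z, L₂, L₁, Y, X]
    (by simp [h12, hX1.symm, hX2.symm, hY1.symm, hY2.symm, hZ1, hZ2, hYX, hZX, hZY])
    (by simp [hL₁, hL₂, hX, hY, hZ])
  simp only [costSum, unionL, Finset.union_empty, Nat.zero_add] at hc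
  have kX := hrest X hX hX1 hX2
  have kY := hrest Y hY hY1 hY2
  have e1 : lineCost w Y X = 1 := by
    rw [lineCost_of_inter_le_two (le_trans (h3 Y hY X hX hYX) (by omega)), kY]
    have := fat_mono w (Finset.sdiff_subset (s := Y) (t := X)); omega
  have e2 : lineCost w L₁ (Y ∪ X) = 2 := by
    rw [lineCost_of_inter_le_two (le_trans (card_inter_union_le L₁ Y X)
      (by have := h3 L₁ hL₁ Y hY hY1.symm; have := h3 L₁ hL₁ X hX hX1.symm; omega)), c1]
    have := fat_mono w (Finset.sdiff_subset (s := L₁) (t := Y ∪ X)); omega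
  have e3 : lineCost w L₂ (L₁ ∪ (Y ∪ X)) = 2 := by
    rw [lineCost_of_inter_le_two (le_trans (card_inter_union_le L₂ L₁ (Y ∪ X))
      (le_trans (Nat.add_le_add_left (card_inter_union_le L₂ Y X) _)
        (by have := h3 L₂ hL₂ Y hY hY2.symm; have := h3 L₂ hL₂ X hX hX2.symm; omega))), c2]
    have := fat_mono w (Finset.sdiff_subset (s := L₂) (t := L₁ ∪ (Y ∪ X))); omega
  rw [lineCost_empty, kX, fX, e1, e2, e3] at hc
  by_contra hsub
  have := one_le_lineCost (w := w) hsub (h2 Z hZ).1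
  omega

include h1 h2 h3 h4 hL₁ hL₂ h12 c1 c2 f1 f2 hrest in
/-- **Without fat points the cap sum is `≤ 16`**: `8` plus at most `8` simple lines — `≤ 3` non-chords by the
counting lemma at budget `2`, and chords with `≤ 1` per hub beyond a common hub, `≤ |L₁ ∖ L₂|` per hub. -/
theorem sum_cap_le_of_simple (hsimple : ∀ X ∈ ls, X ≠ L₁ → X ≠ L₂ → fat w X = 0) :
    ∑ L ∈ ls, capPaper L.card (fat w L) ≤ 16 := by
  set P₀ := L₂ ∪ L₁ with hP₀
  set T := (ls.erase L₁).erase L₂ with hT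
  have hTmem : ∀ Y ∈ T, Y ∈ ls ∧ Y ≠ L₁ ∧ Y ≠ L₂ := by
    intro Y hY
    rw [hT, Finset.mem_erase, Finset.mem_erase] at hY
    exact ⟨hY.2.2, hY.2.1, hY.1⟩
  have hmemT : ∀ Y, Y ∈ ls → Y ≠ L₁ → Y ≠ L₂ → Y ∈ T := fun Y hY hY1 hY2 => by
    rw [hT]; exact Finset.mem_erase.2 ⟨hY2, Finset.mem_erase.2 ⟨hY1, hY⟩⟩
  have hL₂' : L₂ ∈ ls.erase L₁ := Finset.mem_erase.2 ⟨h12, hL₂⟩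
  rw [← Finset.add_sum_erase ls _ hL₁, ← Finset.add_sum_erase _ _ hL₂', ← hT, c1, c2, f1, f2]
  have hcap : ∀ Y ∈ T, capPaper Y.card (fat w Y) = 1 := by
    intro Y hY
    obtain ⟨hYls, hY1, hY2⟩ := hTmem Y hY
    rw [hrest Y hYls hY1 hY2, hsimple Y hYls hY1 hY2]; decide
  rw [Finset.sum_congr rfl hcap, ← Finset.card_eq_sum_ones]
  have e : capPaper 4 0 = 4 := by decide
  rw [e]
  -- the count `#T ≤ 8`
  have hT3 : ∀ Y ∈ T, Y.card = 3 := fun Y hY => hrest Y (hTmem Y hY).1 (hTmem Y hY).2.1 (hTmem Y hY).2.2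
  have hTns : ∀ Y ∈ T, ¬ Y ⊆ P₀ := fun Y hY => not_subset_P₀ h3 hL₁ hL₂ hrest (hTmem Y hY).1 (hTmem Y hY).2.1 (hTmem Y hY).2.2
  have hTpair : ∀ Y ∈ T, ∀ Y' ∈ T, Y ≠ Y' → (Y ∩ Y').card ≤ 1 := fun Y hY Y' hY' hne =>
    h3 Y (hTmem Y hY).1 Y' (hTmem Y' hY').1 hne
  have hfree : ∀ l : List (Finset β), l.Nodup → (∀ L ∈ l, L ∈ T) → freeCountR P₀ l ≤ 2 := fun l hnd hl =>
    free_le_two h1 h2 h3 h4 hL₁ hL₂ h12 c1 c2 f1 f2 hrest l hnd (fun L hL => hTmem L (hl L hL))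
  have hpos : ∀ Y ∈ T, 0 < (Y \ P₀).card := fun Y hY => Finset.card_pos.2 (by
    obtain ⟨v, hvY, hvP⟩ := Finset.not_subset.1 (hTns Y hY)
    exact ⟨v, Finset.mem_sdiff.2 ⟨hvY, hvP⟩⟩)
  set C := T.filter (fun Y => (Y \ P₀).card = 1) with hC
  set D := T.filter (fun Y => ¬ (Y \ P₀).card = 1) with hD
  have hsplit : C.card + D.card = T.card := Finset.card_filter_add_card_filter_not _
  -- non-chords: `≤ 3`
  have hDcard : D.card ≤ 3 := by
    have h := two_mul_card_le_of_freeCountR P₀ 2 D (fun Y hY => by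
        have hYT := (Finset.mem_filter.1 hY).1
        have hne := (Finset.mem_filter.1 hY).2
        have := Finset.card_sdiff_add_card_inter Y P₀
        have := hpos Y hYT
        have := hT3 Y hYT
        exact ⟨hT3 Y hYT, by omega⟩)
      (fun Y hY Y' hY' hne => hTpair Y (Finset.mem_filter.1 hY).1 Y' (Finset.mem_filter.1 hY').1 hne)
      (fun l hnd hl => hfree l hnd (fun L hL => (Finset.mem_filter.1 (hl L hL)).1))
    omega
  -- chords with hub `v`
  have hhub : ∀ Y ∈ C, ∃ v, v ∉ P₀ ∧ Y \ P₀ = {v} := by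
    intro Y hY
    obtain ⟨v, hv⟩ := Finset.card_eq_one.1 (Finset.mem_filter.1 hY).2
    exact ⟨v, (Finset.mem_sdiff.1 (hv ▸ Finset.mem_singleton_self v)).2, hv⟩
  have hCv : ∀ v, (T.filter (fun Y => Y \ P₀ = {v})).card ≤ (L₁ \ L₂).card := fun v =>
    card_chords_le h3 hL₁ hL₂ hrest (ls := ls) (L₁ := L₁) (L₂ := L₂) v
  have hL12 : (L₁ \ L₂).card ≤ 4 := le_trans (Finset.card_le_card Finset.sdiff_subset) (by omega)
  by_cases hone : ∀ Y ∈ C, ∀ Y' ∈ C, Y \ P₀ = Y' \ P₀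
  · -- a common hub (or no chord)
    have hCcard : C.card ≤ 4 := by
      rcases Finset.eq_empty_or_nonempty C with hempty | ⟨Y₀, hY₀⟩
      · rw [hempty]; simp
      obtain ⟨v, -, hv⟩ := hhub Y₀ hY₀
      have hsub : C ⊆ T.filter (fun Y => Y \ P₀ = {v}) := by
        intro Y hY
        exact Finset.mem_filter.2 ⟨(Finset.mem_filter.1 hY).1, (hone Y hY Y₀ hY₀).trans hv⟩
      exact le_trans (Finset.card_le_card hsub) (le_trans (hCv v) hL12)
    omega
  · -- two chords with distinct hubs `n ≠ m`
    simp only [not_forall] at hone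
    obtain ⟨X, hXC, Y, hYC, hXY⟩ := hone
    obtain ⟨n, hnP, hXn⟩ := hhub X hXC
    obtain ⟨m, hmP, hYm⟩ := hhub Y hYC
    have hnm : n ≠ m := fun h => hXY (by rw [hXn, hYm, h])
    have hXT := (Finset.mem_filter.1 hXC).1
    have hYT := (Finset.mem_filter.1 hYC).1
    have hXYne : Y ≠ X := fun h => hXY (by rw [h])
    have hnX : n ∈ X := (Finset.mem_sdiff.1 (hXn ▸ Finset.mem_singleton_self n)).1
    have hmY : m ∈ Y := (Finset.mem_sdiff.1 (hYm ▸ Finset.mem_singleton_self m)).1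
    have hmX : m ∉ X := fun h => hnm (Finset.mem_singleton.1 (hXn ▸ Finset.mem_sdiff.2 ⟨h, hmP⟩)).symm
    have hnY : n ∉ Y := fun h => hnm (Finset.mem_singleton.1 (hYm ▸ Finset.mem_sdiff.2 ⟨h, hnP⟩))
    -- every other line has its new points among `n, m`
    have hclos : ∀ Z ∈ T, Z ≠ X → Z ≠ Y → Z \ P₀ ⊆ {n, m} := by
      intro Z hZ hZX hZY
      have hYnot : ¬ Y ⊆ X ∪ P₀ := fun h => by
        rcases Finset.mem_union.1 (h hmY) with h' | h'
        · exact hmX h'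
        · exact hmP h'
      have hsub := subset_of_free_le_two (hTns X hXT) hYnot
        (hfree [Z, Y, X] (by simp [hXYne, hZX, hZY]) (by simp [hXT, hYT, hZ]))
      intro u hu
      have hu' := Finset.mem_sdiff.1 hu
      rcases Finset.mem_union.1 (hsub hu'.1) with h | h
      · have : u ∈ Y \ P₀ := Finset.mem_sdiff.2 ⟨h, hu'.2⟩
        rw [hYm, Finset.mem_singleton] at this
        rw [this]; simp
      · rcases Finset.mem_union.1 h with h | h
        · have : u ∈ X \ P₀ := Finset.mem_sdiff.2 ⟨h, hu'.2⟩
          rw [hXn, Finset.mem_singleton] at this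
          rw [this]; simp
        · exact absurd h hu'.2
    -- at most one non-chord: its new points are exactly `{n, m}`
    have hDone : D.card ≤ 1 := by
      have hDnm : ∀ Z ∈ D, Z \ P₀ = {n, m} := by
        intro Z hZ
        have hZT := (Finset.mem_filter.1 hZ).1
        have hZne := (Finset.mem_filter.1 hZ).2
        have hZX : Z ≠ X := fun h => hZne (by rw [h, hXn]; simp)
        have hZY : Z ≠ Y := fun h => hZne (by rw [h, hYm]; simp)
        have hsub := hclos Z hZT hZX hZY
        have hcard := Finset.card_le_card hsub
        rw [Finset.card_pair hnm] at hcard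
        have := hpos Z hZT
        exact Finset.eq_of_subset_of_card_le hsub (by rw [Finset.card_pair hnm]; omega)
      rw [Finset.card_le_one]
      intro Z hZ Z' hZ'
      by_contra hne
      have hle := hTpair Z (Finset.mem_filter.1 hZ).1 Z' (Finset.mem_filter.1 hZ').1 hne
      have hsub : {n, m} ⊆ Z ∩ Z' := by
        intro u hu
        have h1' : u ∈ Z \ P₀ := (hDnm Z hZ).symm ▸ hu
        have h2' : u ∈ Z' \ P₀ := (hDnm Z' hZ').symm ▸ hu
        exact Finset.mem_inter.2 ⟨(Finset.mem_sdiff.1 h1').1, (Finset.mem_sdiff.1 h2').1⟩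
      have := Finset.card_le_card hsub
      rw [Finset.card_pair hnm] at this
      omega
    -- the chords: hubs `n` or `m`
    have hCsub : C ⊆ T.filter (fun Z => Z \ P₀ = {n}) ∪ T.filter (fun Z => Z \ P₀ = {m}) := by
      intro Z hZ
      have hZT := (Finset.mem_filter.1 hZ).1
      obtain ⟨v, -, hv⟩ := hhub Z hZ
      by_cases hZX : Z = X
      · exact Finset.mem_union_left _ (Finset.mem_filter.2 ⟨hZT, hZX ▸ hXn⟩)
      by_cases hZY : Z = Y
      · exact Finset.mem_union_right _ (Finset.mem_filter.2 ⟨hZT, hZY ▸ hYm⟩)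
      have hsub := hclos Z hZT hZX hZY
      have hvnm : v ∈ ({n, m} : Finset β) := hsub (hv ▸ Finset.mem_singleton_self v)
      rcases Finset.mem_insert.1 hvnm with rfl | hvm
      · exact Finset.mem_union_left _ (Finset.mem_filter.2 ⟨hZT, hv⟩)
      · rw [Finset.mem_singleton.1 hvm] at hv
        exact Finset.mem_union_right _ (Finset.mem_filter.2 ⟨hZT, hv⟩)
    have hCcard : C.card ≤ (T.filter (fun Z => Z \ P₀ = {n})).card + (T.filter (fun Z => Z \ P₀ = {m})).card :=
      le_trans (Finset.card_le_card hCsub) (Finset.card_union_le _ _)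
    by_cases hdisj : (L₂ ∩ L₁).card = 0
    · -- disjoint big lines: at most one chord per hub (two chords with a common hub cover every line)
      have hhub1 : ∀ v, v ∉ P₀ → ∀ Z ∈ T, Z \ P₀ = {v} → ∀ W ∈ T, W \ P₀ = {v} → Z ≠ W →
          ∀ W' ∈ T, W' ≠ Z → W' ≠ W → W' \ P₀ = {v} := by
        intro v hvP Z hZ hZv W hW hWv hZW W' hW' hW'Z hW'W
        have hsub := subset_of_disjoint h1 h2 h3 h4 hL₁ hL₂ h12 c1 c2 f1 f2 hrest hdisj
          (hTmem Z hZ).1 (hTmem Z hZ).2.1 (hTmem Z hZ).2.2 (hTmem W hW).1 (hTmem W hW).2.1 (hTmem W hW).2.2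
          (hTmem W' hW').1 (hTmem W' hW').2.1 (hTmem W' hW').2.2 (Ne.symm hZW) hW'Z hW'W
          (hsimple Z (hTmem Z hZ).1 (hTmem Z hZ).2.1 (hTmem Z hZ).2.2)
          (hsimple W (hTmem W hW).1 (hTmem W hW).2.1 (hTmem W hW).2.2)
        have hsub' : W' \ P₀ ⊆ {v} := by
          intro u hu
          have hu' := Finset.mem_sdiff.1 hu
          rcases Finset.mem_union.1 (hsub hu'.1) with h | h
          · exact absurd (Finset.mem_union_left _ h) hu'.2
          · rcases Finset.mem_union.1 h with h | h
            · exact absurd (Finset.mem_union_right _ h) hu'.2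
            · rcases Finset.mem_union.1 h with h | h
              · exact hWv ▸ Finset.mem_sdiff.2 ⟨h, hu'.2⟩
              · exact hZv ▸ Finset.mem_sdiff.2 ⟨h, hu'.2⟩
        obtain ⟨u, hu⟩ := Finset.card_pos.1 (hpos W' hW')
        have huv := Finset.mem_singleton.1 (hsub' hu)
        rw [Finset.eq_singleton_iff_unique_mem]
        exact ⟨huv ▸ hu, fun u' hu' => Finset.mem_singleton.1 (hsub' hu')⟩
      -- with two chords of hub `n`, the chord `Y` of hub `m` would have new point `n`
      have hn1 : (T.filter (fun Z => Z \ P₀ = {n})).card ≤ 1 := by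
        rw [Finset.card_le_one]
        intro Z hZ W hW
        by_contra hne
        have hZT := (Finset.mem_filter.1 hZ).1
        have hWT := (Finset.mem_filter.1 hW).1
        have hZn := (Finset.mem_filter.1 hZ).2
        have hWn := (Finset.mem_filter.1 hW).2
        have hYZ : Y ≠ Z := fun h => hnY (h ▸ (Finset.mem_sdiff.1 (hZn ▸ Finset.mem_singleton_self n)).1)
        have hYW : Y ≠ W := fun h => hnY (h ▸ (Finset.mem_sdiff.1 (hWn ▸ Finset.mem_singleton_self n)).1)
        have h := hhub1 n hnP Z hZT hZn W hWT hWn hne Y hYT hYZ hYW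
        rw [hYm] at h
        exact hnm (Finset.singleton_inj.1 h).symm
      have hm1 : (T.filter (fun Z => Z \ P₀ = {m})).card ≤ 1 := by
        rw [Finset.card_le_one]
        intro Z hZ W hW
        by_contra hne
        have hZT := (Finset.mem_filter.1 hZ).1
        have hWT := (Finset.mem_filter.1 hW).1
        have hZm := (Finset.mem_filter.1 hZ).2
        have hWm := (Finset.mem_filter.1 hW).2
        have hXZ : X ≠ Z := fun h => hmX (h ▸ (Finset.mem_sdiff.1 (hZm ▸ Finset.mem_singleton_self m)).1)
        have hXW : X ≠ W := fun h => hmX (h ▸ (Finset.mem_sdiff.1 (hWm ▸ Finset.mem_singleton_self m)).1)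
        have h := hhub1 m hmP Z hZT hZm W hWT hWm hne X hXT hXZ hXW
        rw [hXn] at h
        exact hnm (Finset.singleton_inj.1 h)
      omega
    · -- the big lines meet: `|L₁ ∖ L₂| ≤ 3`
      have hL12' : (L₁ \ L₂).card ≤ 3 := by
        have := Finset.card_sdiff_add_card_inter L₁ L₂
        rw [Finset.inter_comm] at this
        omega
      have := hCv n
      have := hCv m
      omega

include h1 h2 h3 h4 hL₁ hL₂ h12 c1 c2 f1 f2 hrest in
/-- **Two simple 4-point lines: cap sum `≤ 16`** — by whether some other line carries a fat point. -/
theorem sum_cap_le_sixteen_of_two_four : ∑ L ∈ ls, capPaper L.card (fat w L) ≤ 16 := by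
  by_cases hfat : ∃ X ∈ ls, X ≠ L₁ ∧ X ≠ L₂ ∧ ∃ v ∈ X, w v = 2
  · obtain ⟨X, hX, hX1, hX2, v, hvX, hv2⟩ := hfat
    exact sum_cap_le_of_fat h1 h2 h3 h4 hL₁ hL₂ h12 c1 c2 f1 f2 hrest hX hX1 hX2 hvX hv2
  · refine sum_cap_le_of_simple h1 h2 h3 h4 hL₁ hL₂ h12 c1 c2 f1 f2 hrest (fun X hX hX1 hX2 => ?_)
    unfold fat
    rw [Finset.card_eq_zero, Finset.filter_eq_empty_iff]
    intro v hv hv2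
    exact hfat ⟨X, hX, hX1, hX2, v, hv, hv2⟩

end TwoFourSimple

end FourCap

end S1

end PercRepro
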